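import Mathlib

/-!
# The Cook–Mertz interpolation identity (roots-of-unity averaging along a line)

J. Cook, I. Mertz, *Tree Evaluation Is in Space O(log n · log log n)*, STOC 2024, 1268–1278
[CookMertz2024] (ECCC TR23-174; held as `paper:url-b3bb217772f1`, clean text; the ACM version
`paper:doi-10-1145-3618260-3649664` numbers the same statements Prop. 5 / Cor. 6 / Lemma 7 / Lemma 8).
The algebraic core of the Cook–Mertz tree-evaluation procedure and of R. Williams's
`TIME[t] ⊆ SPACE[√(t log t)]` (STOC 2025, App. A, eq. (3)) — "merely a special case of univariate
polynomial interpolation" (O. Goldreich, ECCC TR24-109, p. 1):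

* TR23-174 **Proposition 8** (p. 6, verbatim): "Let ω_m be a primitive root of unity of order m.
  Then for all 0 < b < m, Σ_{j=1}^{m} ω_m^{jb} = 0."  — `IsPrimitiveRoot.sum_pow_mul_eq_zero` below
  (any commutative ring that is a domain; we sum over `j ∈ range m`, the same multiset of powers).
* TR23-174 **Corollary 9** (p. 7): in a finite field with m = |F| − 1, "m^{-1} Σ_{j=1}^m ω_m^{jb} =
  [b = 0]" with "m^{-1} = −1" because "m ≡ −1 (mod p)" — `cast_card_sub_one` below.
* TR23-174 **Lemma 12** (p. 8, verbatim; = STOC Lemma 8): "Let d, m, K be such that |K| − 1 = m > d,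
  let p : Kⁿ → K be a degree-d polynomial, and let τ_i, x_i be elements of K for i ∈ [n]. Then
  Σ_{j=1}^{m} m^{-1} p(ω_m^j τ_1 + x_1, …, ω_m^j τ_n + x_n) = p(x_1, …, x_n)."
  (TR23-174 Lemma 11 = STOC Lemma 7 is the monomial case `Π_i (ω^j τ_i + x_i)`.)

What is PROVED here, in the generality the kernel proof of the procedure needs (cell pnp-ideate,
seat p3, typed target `CookMertzInterpolation`): over ANY field `F`, for ANY primitive `m`-th root
of unity `ω` and ANY multivariate polynomial `P` of total degree `< m` (not necessarily
multilinear, any index type),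
`Σ_{i < m} P(ω^i • x + v) = m • P(v)`  (`cookMertz_interpolation`);
hence in a finite field with `m = |K| − 1` (so `(m : K) = −1`) the printed form
`Σ_{i < m} (−1) · P(ω^i • τ + x) = P(x)` (`cookMertz_interpolation_finiteField`), and the existence
of such an `ω` (TR23-174 Prop. 7, `exists_isPrimitiveRoot_card_sub_one`). Proof: restrict `P` to
the line `y ↦ y • x + v` — a univariate polynomial `Q` of degree `≤ totalDegree P < m` with
`Q(0) = P(v)` — and average `Q` over the `m`-th roots of unity: every monomial `y^k`, `0 < k < m`,
averages to `0` (Prop. 8), the constant term survives `m` times.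
-/

noncomputable section

open Polynomial Finset

namespace Literature.Computability.Complexity

namespace CookMertz

variable {F : Type*} [Field F] {σ : Type*}

/-- **TR23-174 Proposition 8**: for a primitive `m`-th root of unity `ω` and `0 < b < m`,
`Σ_{j < m} ω^{j b} = 0` (stated as `Σ_j (ω^b)^j = 0`). [cite: CookMertz2024, Prop. 5 (= ECCC TR23-174 Prop. 8)] -/
theorem sum_pow_mul_eq_zero {m : ℕ} {ω : F} (hω : IsPrimitiveRoot ω m) {b : ℕ} (hb0 : b ≠ 0)
    (hbm : b < m) : ∑ j ∈ range m, (ω ^ b) ^ j = 0 := by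
  have hne : ω ^ b ≠ 1 := hω.pow_ne_one_of_pos_of_lt hb0 hbm
  rw [geom_sum_eq hne, ← pow_mul, mul_comm, pow_mul, hω.pow_eq_one, one_pow, sub_self, zero_div]

/-- The restriction of `P` to the line `y ↦ y • x + v`: the univariate polynomial
`Q(y) = P(y x_1 + v_1, …)`. [cite: CookMertz2024, Lemma 8 (proof: "substituting ω^j τ_i + x_i for each y_i")] -/
def lineRestrict (P : MvPolynomial σ F) (x v : σ → F) : F[X] :=
  MvPolynomial.aeval (fun s => C (x s) * X + C (v s)) P

/-- Evaluating the line restriction at `y` is evaluating `P` at the point `y • x + v`.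
[cite: CookMertz2024, Lemma 8] -/
theorem eval_lineRestrict (P : MvPolynomial σ F) (x v : σ → F) (y : F) :
    (lineRestrict P x v).eval y = MvPolynomial.eval (fun s => y * x s + v s) P := by
  unfold lineRestrict
  have h := DFunLike.congr_fun
    (MvPolynomial.comp_aeval (f := fun s => C (x s) * X + C (v s)) (Polynomial.aeval (R := F) y)) P
  rw [AlgHom.comp_apply, Polynomial.coe_aeval_eq_eval] at h
  have hfun : (fun s => (C (x s) * X + C (v s)).eval y) = fun s => y * x s + v s := by
    funext s
    rw [eval_add, eval_mul, eval_C, eval_X, eval_C, mul_comm]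
  rw [h, hfun, MvPolynomial.aeval_def, Algebra.algebraMap_self]
  rfl

/-- The line restriction has degree at most the total degree of `P`.
[cite: CookMertz2024, Lemma 8 ("a degree-d polynomial")] -/
theorem natDegree_lineRestrict_le (P : MvPolynomial σ F) (x v : σ → F) :
    (lineRestrict P x v).natDegree ≤ P.totalDegree := by
  have h := MvPolynomial.aeval_natDegree_le (n := 1) P le_rfl
    (fun s => C (x s) * X + C (v s)) (fun s => by compute_degree)
  simpa [lineRestrict] using h

/-- Averaging a univariate polynomial of degree `< m` over the `m`-th roots of unity returns
`m` times its constant term. [cite: CookMertz2024, Lemma 7–8 (= TR23-174 Lemmas 11–12)] -/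
theorem sum_eval_pow_eq {m : ℕ} {ω : F} (hω : IsPrimitiveRoot ω m) (Q : F[X])
    (hQ : Q.natDegree < m) : ∑ i ∈ range m, Q.eval (ω ^ i) = (m : F) * Q.eval 0 := by
  rw [← Polynomial.coeff_zero_eq_eval_zero]
  simp_rw [Q.eval_eq_sum_range]
  rw [sum_comm]
  -- the `k = 0` term gives `m • Q.coeff 0`; every other term vanishes
  rw [sum_eq_single_of_mem 0 (by simp) ?_]
  · simp [mul_comm]
  · intro k hk hk0
    have hkm : k < m := by
      have := mem_range.mp hk
      omega
    rw [← mul_sum]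
    simp_rw [← pow_mul, mul_comm _ k, pow_mul]
    rw [sum_pow_mul_eq_zero hω hk0 hkm, mul_zero]

end CookMertz

open CookMertz

/-- **Cook–Mertz interpolation identity** (general form of STOC 2024 Lemma 8 = ECCC TR23-174
Lemma 12; Williams 2025 App. A eq. (3); Goldreich TR24-109 §2): over a field `F`, for a primitive
`m`-th root of unity `ω` and a multivariate polynomial `P` of total degree `< m`,
`Σ_{i < m} P(ω^i x_1 + v_1, …, ω^i x_n + v_n) = m · P(v_1, …, v_n)` for all vectors `x, v`.
-- TODO(general form): none needed — this IS the general form; the printed finite-field reading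
-- (`m = |K| − 1`, `m^{-1} = −1`, sum over `j = 1..m`) is `cookMertz_interpolation_finiteField`.
[cite: CookMertz2024, Lemma 8 (= ECCC TR23-174 Lemma 12)] -/
theorem cookMertz_interpolation {F : Type*} [Field F] {σ : Type*} {m : ℕ} {ω : F}
    (hω : IsPrimitiveRoot ω m) (P : MvPolynomial σ F) (hP : P.totalDegree < m) (x v : σ → F) :
    ∑ i ∈ range m, MvPolynomial.eval (fun s => ω ^ i * x s + v s) P =
      (m : F) * MvPolynomial.eval v P := by
  have h := sum_eval_pow_eq hω (lineRestrict P x v)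
    ((natDegree_lineRestrict_le P x v).trans_lt hP)
  simp_rw [eval_lineRestrict] at h
  simpa using h

/-- In a finite field `K` with `|K| = m + 1`, `(m : K) = −1` ("m ≡ −1 (mod p)", TR23-174 Cor. 9).
[cite: CookMertz2024, Cor. 6 (= ECCC TR23-174 Cor. 9)] -/
theorem cast_card_sub_one {K : Type*} [Field K] [Fintype K] {m : ℕ} (hm : Fintype.card K = m + 1) :
    (m : K) = -1 := by
  have h : ((Fintype.card K : ℕ) : K) = 0 := FiniteField.cast_card_eq_zero K
  rw [hm, Nat.cast_succ] at h
  exact eq_neg_of_add_eq_zero_left h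

/-- **The printed finite-field form** (TR23-174 Lemma 12 / STOC Lemma 8 with `m^{-1} = −1`): in a
finite field `K` with `m = |K| − 1 > totalDegree P` and `ω` a primitive `m`-th root of unity,
`Σ_{i < m} (−1) · P(ω^i τ_1 + x_1, …) = P(x_1, …)`. [cite: CookMertz2024, Lemma 8 (= ECCC TR23-174 Lemma 12)] -/
theorem cookMertz_interpolation_finiteField {K : Type*} [Field K] [Fintype K] {σ : Type*} {m : ℕ}
    (hm : Fintype.card K = m + 1) {ω : K} (hω : IsPrimitiveRoot ω m) (P : MvPolynomial σ K)
    (hP : P.totalDegree < m) (τ x : σ → K) :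
    ∑ i ∈ range m, (-1) * MvPolynomial.eval (fun s => ω ^ i * τ s + x s) P =
      MvPolynomial.eval x P := by
  rw [← mul_sum, cookMertz_interpolation hω P hP τ x, cast_card_sub_one hm]
  ring

/-- **TR23-174 Proposition 7**: a finite field `K` has a primitive root of unity of order `|K| − 1`
(the unit group is cyclic). [cite: CookMertz2024, §3 (= ECCC TR23-174 Prop. 7)] -/
theorem exists_isPrimitiveRoot_card_sub_one (K : Type*) [Field K] [Fintype K] :
    ∃ ω : K, IsPrimitiveRoot ω (Fintype.card K - 1) := by
  classical
  obtain ⟨g, hg⟩ := IsCyclic.exists_ofOrder_eq_natCard (α := Kˣ)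
  refine ⟨(g : K), ?_⟩
  have h1 : orderOf (g : K) = Fintype.card K - 1 := by
    rw [orderOf_units, hg, Nat.card_eq_fintype_card, Fintype.card_units]
  exact h1 ▸ IsPrimitiveRoot.orderOf (g : K)

end Literature.Computability.Complexity
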